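import Mathlib
import Summits.Ventures.PercRepro2.HCov
import Summits.Ventures.PercRepro2.CPolarA3
import Summits.Ventures.PercRepro2.CPolarA3Marks
import Summits.Ventures.PercRepro2.PendantClusterBern
import Summits.Ventures.PercRepro2.CPolarA3Exists

/-!
# The chain of record on the CPOLAR road (blind cell PercRepro2, p5 g15; `proofs/P5-OEDGE.md` §17)

`CPolar_all ⟹ CPolarA3_all ⟹ CPolarA3NR_all ⟹ CPolarA3Free_all ⟹ CPolarA3NP_all ⟹ CPolarA3Exists_all
⟹ HCov_all`: every arrow is in the tree (`cpolarA3_all_of_cpolar_all`, `cpolarA3NR_all_of_cpolarA3_all`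
below, `cpolarA3Free_all_of_cpolarA3NR_all`, `cpolarA3NP_all_of_cpolarA3Free_all`,
`cpolarA3Exists_all_of_cpolarA3NP_all`, `HCov_all_of_cpolarA3Exists_all`), and
**`HCov_all_of_cpolar_all'`** composes them: row 2′CPOLAR implies the crux through the weakest link.
-/

namespace Summit.Ventures.PercRepro2

open CovForm CovForm.CPolarA3 PendantCluster CPolarA3Exists

namespace CPolarA3Chain

variable (R : Type*) [Field R] [LinearOrder R] [IsStrictOrderedRing R]

omit [IsStrictOrderedRing R] in
/-- `CPolarA3NR_all` is weaker than `CPolarA3_all` (the missing link of CPolarA3.lean). -/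
theorem cpolarA3NR_all_of_cpolarA3_all (h : CPolarA3_all R) : CPolarA3NR_all R := by
  intro V E _ _ _ _ ends p hp o a₁ a₂ a₃ b h1 h2 h3 h4 h5 h6 h7 h8 h9 h10 e h0 h1' ht _
  exact h V E ends p hp o a₁ a₂ a₃ b h1 h2 h3 h4 h5 h6 h7 h8 h9 h10 e h0 h1' ht

/-- **The chain composed**: row 2′CPOLAR ⟹ … ⟹ one good `a₃`-edge per instance ⟹ the crux. -/
theorem HCov_all_of_cpolar_all' (h : CPolar_all R) : HCov_all R :=
  HCov_all_of_cpolarA3Exists_all R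
    (cpolarA3Exists_all_of_cpolarA3NP_all R
      (cpolarA3NP_all_of_cpolarA3Free_all R
        (cpolarA3Free_all_of_cpolarA3NR_all R
          (cpolarA3NR_all_of_cpolarA3_all R (cpolarA3_all_of_cpolar_all R h)))))

end CPolarA3Chain

end Summit.Ventures.PercRepro2
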